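import Literature.Geometry.Lorentzian.RicciVariationSteps
import Literature.Geometry.Lorentzian.RicciNormSq
import Literature.Geometry.Lorentzian.RicciDecay
import Literature.Geometry.Lorentzian.EndVolume
import Literature.Geometry.Lorentzian.VolumeProofs
import HarnessLib

/-!
# The Ricci variation of Schoen–Yau, III: the elementary steps proved

Two steps of Schoen–Yau's Ricci variation (Comm. Math. Phys. 65 (1979), §3, (3.24)–(3.30): the
mass function `M(t)` of `φ_t⁴ (ds² + t Ric)` has `M'(0) = c ∫_N ‖Ric‖² dx > 0` unless `Ric ≡ 0`)
are elementary — the finiteness of `∫_N ‖Ric‖²` and its positivity when `Ric ≢ 0` — and are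
**proved** here and in `RicciNormSq.lean`:

* `integrable_normSq_ricci` — **`‖Ric‖²_h` is integrable** on a manifold with one
  strongly asymptotically flat end (`h − δ = o₅(r⁻²)`, the complement of a far region compact):
  continuity on a compact core (the Riemannian measure is finite on compact sets,
  `VolumeProofs.lean`) and, on the far region, the chart formula for the Riemannian measure
  (`AFEnd.setLIntegral_far`, `EndVolume.lean`), the decay `‖Ric‖²(Φ z) ≤ K ‖z‖⁻⁸` and the
  density bound `√(det h_{ij}) ≤ 7` (`RicciDecay.lean`), and `∫_{‖z‖ > R} ‖z‖⁻⁸ dz < ∞`;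
* `integral_normSq_ricci_pos` (`RicciNormSq.lean`) — `∫ ‖Ric‖²_h dV > 0` if `Ric ≢ 0`.

Both are consumed by the reduction of step 2 of positive mass rigidity to the elliptic steps of
the printed proof (`exists_ricciVariation_negativeMass_of_massZero_of_elliptic_steps`,
`RicciVariationEllipticSteps.lean`). No named facts are introduced.

## References

* R. Schoen, S.-T. Yau, *On the proof of the positive mass conjecture in general relativity*,
  Comm. Math. Phys. 65 (1979) 45–76, §3, pp. 72–74, (3.24)–(3.30), Lemma 3.3.
-/

noncomputable section

open Bundle Set Function Filter TopologicalSpace Manifold Metric MeasureTheory Measure Asymptotics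
open scoped Manifold ContDiff Topology ENNReal

namespace Literature.Geometry.Lorentzian

/-! ### `‖Ric‖²` is integrable on a one-ended asymptotically flat manifold -/

/-- **`∫_N ‖Ric‖² dx < ∞`** (the finiteness implicit in Schoen–Yau 1979, (3.30)): for data
`D = (h, k)` on a `3`-manifold `X` with an end `e` on which `h − δ = o₅(r⁻²)`
(`IsStronglyAsymptoticallyFlatWith D 0 2 0 5 0`) and which is the only end (`IsSoleEnd`: the
complement of a far region is compact), `‖Ric‖²_h` is integrable for the Riemannian measure.
Proof: `‖Ric‖²_h` is continuous (`contMDiff_normSq_ricci'`), hence integrable on the compact set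
`(far R')ᶜ ∪ Φ({R' ≤ ‖z‖ ≤ R₂})` (the Riemannian measure is finite on compact sets,
`riemannianVolume_lt_top_of_isCompact_holds`); on the far region `{R₂ < r}` the chart formula
`∫_{far} g dvol_h = ∫ g(Φ z) √(det h_{ij}) dz` (`AFEnd.setLIntegral_far`, `EndVolume.lean`), the
decay `‖Ric‖²(Φ z) ≤ K ‖z‖⁻⁸` (`AFEnd.exists_bound_normSq_ricci` with `α = 2`) and the bound
`√(det h_{ij}) ≤ 7` (`AFEnd.exists_radius_sqrt_det_hCoeff_le`) reduce it to
`∫_{‖z‖ > R₂} ‖z‖⁻⁸ dz < ∞` (`AFEnd.integrableOn_rpow_neg_exterior`).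
[cite: SchoenYauPMT1979, §3 p. 74, (3.30)] -/
theorem integrable_normSq_ricci {X : Type} [TopologicalSpace X] [ChartedSpace E3 X]
    [IsManifold (𝓡 3) ∞ X] [T2Space X] [LocallyCompactSpace X] [MeasurableSpace X] [BorelSpace X]
    (D : InitialDataSet (𝓡 3) X) [D.metric.HasLeviCivita] (e : AFEnd X)
    (haf : e.IsStronglyAsymptoticallyFlatWith D 0 2 0 5 0) (hsole : e.IsSoleEnd) :
    Integrable (fun x ↦ D.metric.normSq x (D.metric.ricci x)) (riemannianMeasure D.h) := by
  set μ : Measure X := riemannianMeasure D.h with hμ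
  set f : X → ℝ := fun x ↦ D.metric.normSq x (D.metric.ricci x) with hf
  have hfc : Continuous f := (D.metric.contMDiff_normSq_ricci').continuous
  have hf0 : ∀ x, 0 ≤ f x := fun x ↦ D.metric.normSq_nonneg x D.isRiemannian_metric _
  haveI : IsFiniteMeasureOnCompacts μ :=
    ⟨fun K hK ↦ riemannianVolume_lt_top_of_isCompact_holds D.h le_rfl hK⟩
  -- decay on the end and the density bound
  have hAF : e.IsMetricAsymptoticallyFlat D 2 :=
    AFEnd.IsStronglyAsymptoticallyFlatWith.isMetricAsymptoticallyFlat_of_massZero e D haf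
      (by norm_num)
  obtain ⟨K, R₁, hRR₁, h1R₁, hbound⟩ := e.exists_bound_normSq_ricci D two_pos hAF
  obtain ⟨R₃, hdens⟩ := e.exists_radius_sqrt_det_hCoeff_le D two_pos hAF
  obtain ⟨R', hRR', hcpt⟩ := hsole
  set R₂ : ℝ := max (max R₁ R₃) R' with hR₂
  have hR₁R₂ : R₁ ≤ R₂ := (le_max_left _ _).trans (le_max_left _ _)
  have hR₃R₂ : R₃ ≤ R₂ := (le_max_right _ _).trans (le_max_left _ _)
  have hR'R₂ : R' ≤ R₂ := le_max_right _ _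
  have hRR₂ : e.R ≤ R₂ := hRR'.le.trans hR'R₂
  -- the compact piece
  set A : Set E3 := {z | R' ≤ ‖z‖ ∧ ‖z‖ ≤ R₂} with hA
  have hAext : A ⊆ {z | e.R < ‖z‖} := fun z hz ↦ hRR'.trans_le hz.1
  have hAc : IsCompact A := by
    have : A = closedBall (0 : E3) R₂ ∩ {z | R' ≤ ‖z‖} := by
      ext z
      simp only [hA, mem_setOf_eq, mem_inter_iff, mem_closedBall_zero_iff]
      tauto
    rw [this]
    exact (isCompact_closedBall _ _).inter_right (isClosed_le continuous_const continuous_norm)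
  have hcont : ContinuousOn e.dataChartExt {z | e.R < ‖z‖} := fun z hz ↦
    (e.contMDiffAt_dataChartExt hz).continuousAt.continuousWithinAt
  set Kc : Set X := (e.far R')ᶜ ∪ e.dataChartExt '' A with hKc
  have hKc_cpt : IsCompact Kc := hcpt.union (hAc.image_of_continuousOn (hcont.mono hAext))
  have hcover : (univ : Set X) ⊆ Kc ∪ e.far R₂ := by
    intro p _
    by_cases hp : p ∈ e.far R₂
    · exact Or.inr hp
    by_cases hp' : p ∈ e.far R'
    · obtain ⟨z, hz, rfl⟩ := e.mem_far_iff.1 hp'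
      refine Or.inl (Or.inr ⟨z, ⟨hz.le, ?_⟩, e.dataChartExt_of_lt z.2⟩)
      by_contra hlt
      push Not at hlt
      exact hp (e.mem_far_iff.2 ⟨z, hlt, rfl⟩)
    · exact Or.inl (Or.inl hp')
  -- integrability on the compact piece
  have hint_K : IntegrableOn f Kc μ := hfc.continuousOn.integrableOn_compact hKc_cpt
  -- integrability on the far region
  have hint_far : IntegrableOn f (e.far R₂) μ := by
    refine ⟨hfc.aestronglyMeasurable.restrict, ?_⟩
    rw [hasFiniteIntegral_iff_enorm]
    have hen : ∀ p, ‖f p‖ₑ = ENNReal.ofReal (f p) := fun p ↦ Real.enorm_eq_ofReal (hf0 p)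
    simp only [hen]
    rw [e.setLIntegral_far D (fun p ↦ ENNReal.ofReal (f p)) hRR₂]
    -- bound the integrand by `7 K ‖z‖⁻⁸`
    have hg : IntegrableOn (fun z : E3 ↦ 7 * K * ‖z‖ ^ (-(8 : ℝ))) {z | R₂ < ‖z‖} volume := by
      have := (AFEnd.integrableOn_rpow_neg_exterior (by norm_num : (3 : ℝ) < 8)
        (h1R₁.trans hR₁R₂)).const_mul (7 * K)
      exact this
    refine lt_of_le_of_lt (setLIntegral_mono'
      (isOpen_lt continuous_const continuous_norm).measurableSet (fun z hz ↦ ?_))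
      (hasFiniteIntegral_iff_enorm.1 hg.2)
    have hzR₁ : R₁ ≤ ‖z‖ := hR₁R₂.trans (le_of_lt hz)
    have hzR₃ : R₃ ≤ ‖z‖ := hR₃R₂.trans (le_of_lt hz)
    have hb := hbound z hzR₁
    have hd := hdens z hzR₃
    have h8 : ‖z‖ ^ (-(2 * (2 : ℝ) + 4)) = ‖z‖ ^ (-(8 : ℝ)) := by norm_num
    rw [h8] at hb
    have hKnn : 0 ≤ K * ‖z‖ ^ (-(8 : ℝ)) := (hf0 _).trans hb
    have h7 : 0 ≤ 7 * K * ‖z‖ ^ (-(8 : ℝ)) := by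
      rw [mul_assoc]
      exact mul_nonneg (by norm_num) hKnn
    calc ENNReal.ofReal (f (e.dataChartExt z)) * ENNReal.ofReal (Real.sqrt (Matrix.of fun i j ↦
          AFEnd.hCoeff e D z (EuclideanSpace.single i 1) (EuclideanSpace.single j 1)).det)
        ≤ ENNReal.ofReal (K * ‖z‖ ^ (-(8 : ℝ))) * ENNReal.ofReal 7 :=
          mul_le_mul' (ENNReal.ofReal_le_ofReal hb) (ENNReal.ofReal_le_ofReal hd)
      _ = ‖7 * K * ‖z‖ ^ (-(8 : ℝ))‖ₑ := by
          rw [← ENNReal.ofReal_mul hKnn, Real.enorm_eq_ofReal h7]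
          congr 1
          ring
  -- conclusion
  exact integrableOn_univ.1 ((hint_K.union hint_far).mono_set hcover)

end Literature.Geometry.Lorentzian

end
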